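import Mathlib
import Summits.NavierStokesRegularity.NavierStokesRegularity.Theorems.TypeILiouvilleLatticeLiouville
import Summits.NavierStokesRegularity.NavierStokesRegularity.Theorems.TypeILiouvilleQuiescentShadow

/-!
# TypeILiouvilleLatticeSieve — crux (L) stmt-NavierStokesRegularity-10661 `TypeIliouvilleL`:
# the crux and its registered stubs SIEVED off the spatially periodic stratum (by name)

Helper for stmt-NavierStokesRegularity-10661 (`--supports`); theorems only, no definitions, no named-fact
hypotheses; closes no item; Navier–Stokes regularity is NOT proved here (leafhand seat of the
EulerZoomLiouville route, LAND-ONLY).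

With the periodic sieve `TypeILiouvilleLatticeMomentum.classP_const_of_isLatticePeriodic` (every member of
print's class P with `ℤ³`-periodic slices is one constant vector) the spatially periodic members drop out of
the crux and of both registered class-P stubs, EXACTLY:

* `liouvilleL_iff_offLattice` — **(L) ⟺ (L) restricted to class-P members that are NOT `ℤ³`-periodic on
  `t < 0`** (through the landed gauge bridges `TypeILiouvilleQuiescentShadow.oseenMild_const_of_liouvilleL'` /
  `liouvilleL_of_oseenMild_const'`).
* `quiescentLiouville_iff_offLattice` — the registered stub `stub_quiescentLiouville` (L_Q, binders verbatim)
  ⟺ its restriction to non-periodic members.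
* `persistentL3_iff_offLattice` — the registered stub `stub_persistent_mild_backward_L3_recurrence` (binders
  verbatim) ⟺ its restriction to non-periodic members (a periodic member is a constant `b`, recurrent in
  `L³` modulo `b` with `M = 0`).

[cite: KochNadirashviliSereginSverak2009, §4 p. 8 and Remark 6.1 (arXiv:0709.3599)]
-/

noncomputable section
open MeasureTheory Filter Set Function Metric
open scoped Topology ENNReal NNReal
open Literature.Analysis Literature.Analysis.FunctionSpaces Literature.Analysis.FluidPDE
set_option linter.dupNamespace false
namespace Summit.NavierStokesRegularity.NavierStokesRegularity.Theorems.TypeILiouvilleLatticeMomentum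

/-- **(L) sieved off the lattice-periodic stratum.**  The KNSS Liouville crux `Theses.TypeILiouville.TypeIliouvilleL`
is equivalent to its restriction to those members of print's class P (continuous, bounded, weakly
divergence-free, Oseen-mild on `(−∞,0)`) whose slices are NOT all `ℤ³`-periodic; the periodic members are
constant by `classP_const_of_isLatticePeriodic`. [cite: KochNadirashviliSereginSverak2009, §4 p. 8 (arXiv:0709.3599)] -/
theorem liouvilleL_iff_offLattice :
    Theses.TypeILiouville.TypeIliouvilleL ↔
      (∀ v : ℝ → EuclideanSpace ℝ (Fin 3) → EuclideanSpace ℝ (Fin 3),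
        ContinuousOn (uncurry v) (Iio 0 ×ˢ univ) →
        (∃ K : ℝ, ∀ t < 0, ∀ x, ‖v t x‖ ≤ K) →
        (∀ t < 0, IsWeaklyDivFree (v t)) →
        (∀ s t : ℝ, s < t → t < 0 → ∀ x,
          v t x = UnboundedOperators.heatExtension (v s) (t - s) x - oseenDuhamel 1 s v v t x) →
        ¬ (∀ t < 0, Torus.IsLatticePeriodic (v t)) →
        ∃ b : EuclideanSpace ℝ (Fin 3), ∀ t < 0, ∀ x, v t x = b) := by
  constructor
  · intro hL v hc hK hd hm _
    exact TypeILiouvilleQuiescentShadow.oseenMild_const_of_liouvilleL' hL v hc hK hd hm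
  · intro hX
    refine TypeILiouvilleQuiescentShadow.liouvilleL_of_oseenMild_const' fun v hc hK hd hm => ?_
    by_cases hper : ∀ t < 0, Torus.IsLatticePeriodic (v t)
    · exact classP_const_of_isLatticePeriodic hc hK hd hm hper
    · exact hX v hc hK hd hm hper

/-- **L_Q sieved off the lattice-periodic stratum.**  The registered stub `stub_quiescentLiouville` of the (L)
crux (binders verbatim on the left) is equivalent to its restriction to non-periodic members of print's class.
[cite: KochNadirashviliSereginSverak2009, §4 p. 8 (arXiv:0709.3599)] -/
theorem quiescentLiouville_iff_offLattice :
    (∀ v : ℝ → EuclideanSpace ℝ (Fin 3) → EuclideanSpace ℝ (Fin 3),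
      ContinuousOn (Function.uncurry v) (Set.Iio 0 ×ˢ Set.univ) →
      (∃ K : ℝ, ∀ t < 0, ∀ x, ‖v t x‖ ≤ K) →
      (∀ t < 0, IsWeaklyDivFree (v t)) →
      (∀ s t : ℝ, s < t → t < 0 → ∀ x,
        v t x = UnboundedOperators.heatExtension (v s) (t - s) x - oseenDuhamel 1 s v v t x) →
      (∀ ε : ℝ, 0 < ε → ∃ T : ℝ, T < 0 ∧ ∀ t < T, ∀ x y : EuclideanSpace ℝ (Fin 3),
        dist x y ≤ 1 → ‖v t x - v t y‖ ≤ ε) →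
      ∃ b : EuclideanSpace ℝ (Fin 3), ∀ t < 0, ∀ x, v t x = b) ↔
    (∀ v : ℝ → EuclideanSpace ℝ (Fin 3) → EuclideanSpace ℝ (Fin 3),
      ContinuousOn (Function.uncurry v) (Set.Iio 0 ×ˢ Set.univ) →
      (∃ K : ℝ, ∀ t < 0, ∀ x, ‖v t x‖ ≤ K) →
      (∀ t < 0, IsWeaklyDivFree (v t)) →
      (∀ s t : ℝ, s < t → t < 0 → ∀ x,
        v t x = UnboundedOperators.heatExtension (v s) (t - s) x - oseenDuhamel 1 s v v t x) →
      (∀ ε : ℝ, 0 < ε → ∃ T : ℝ, T < 0 ∧ ∀ t < T, ∀ x y : EuclideanSpace ℝ (Fin 3),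
        dist x y ≤ 1 → ‖v t x - v t y‖ ≤ ε) →
      ¬ (∀ t < 0, Torus.IsLatticePeriodic (v t)) →
      ∃ b : EuclideanSpace ℝ (Fin 3), ∀ t < 0, ∀ x, v t x = b) := by
  constructor
  · intro hQ v hc hK hd hm hq _
    exact hQ v hc hK hd hm hq
  · intro hX v hc hK hd hm hq
    by_cases hper : ∀ t < 0, Torus.IsLatticePeriodic (v t)
    · exact classP_const_of_isLatticePeriodic hc hK hd hm hper
    · exact hX v hc hK hd hm hq hper

/-- **The backward-`L³`-recurrence stub sieved off the lattice-periodic stratum.**  The registered stub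
`stub_persistent_mild_backward_L3_recurrence` of the (L) crux (binders verbatim on the left) is equivalent to
its restriction to non-periodic members: a periodic member is a constant `b` (`classP_const_of_isLatticePeriodic`),
which recurs in `L³` modulo `b` along `τ_k = −(k+1)` with `M = 0`. [cite: KochNadirashviliSereginSverak2009, §4 p. 8 (arXiv:0709.3599)] -/
theorem persistentL3_iff_offLattice :
    (∀ v : ℝ → EuclideanSpace ℝ (Fin 3) → EuclideanSpace ℝ (Fin 3),
      ContinuousOn (uncurry v) (Iio 0 ×ˢ univ) →
      (∃ K : ℝ, ∀ t < 0, ∀ x, ‖v t x‖ ≤ K) →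
      (∀ t < 0, IsWeaklyDivFree (v t)) →
      (∀ s t : ℝ, s < t → t < 0 → ∀ x,
        v t x = UnboundedOperators.heatExtension (v s) (t - s) x - oseenDuhamel 1 s v v t x) →
      (¬ ∃ C : ℝ, ∀ t < 0, ∀ x, ‖v t x‖ ≤ C / Real.sqrt (-t)) →
      ∃ (b : ℕ → EuclideanSpace ℝ (Fin 3)) (τ : ℕ → ℝ) (M : NNReal), (∀ k, τ k < 0) ∧
        Tendsto τ atTop atBot ∧
        ∀ k, eLpNorm (fun x => v (τ k) x - b k) 3 (volume : Measure (EuclideanSpace ℝ (Fin 3))) ≤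
          (M : ENNReal)) ↔
    (∀ v : ℝ → EuclideanSpace ℝ (Fin 3) → EuclideanSpace ℝ (Fin 3),
      ContinuousOn (uncurry v) (Iio 0 ×ˢ univ) →
      (∃ K : ℝ, ∀ t < 0, ∀ x, ‖v t x‖ ≤ K) →
      (∀ t < 0, IsWeaklyDivFree (v t)) →
      (∀ s t : ℝ, s < t → t < 0 → ∀ x,
        v t x = UnboundedOperators.heatExtension (v s) (t - s) x - oseenDuhamel 1 s v v t x) →
      (¬ ∃ C : ℝ, ∀ t < 0, ∀ x, ‖v t x‖ ≤ C / Real.sqrt (-t)) →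
      ¬ (∀ t < 0, Torus.IsLatticePeriodic (v t)) →
      ∃ (b : ℕ → EuclideanSpace ℝ (Fin 3)) (τ : ℕ → ℝ) (M : NNReal), (∀ k, τ k < 0) ∧
        Tendsto τ atTop atBot ∧
        ∀ k, eLpNorm (fun x => v (τ k) x - b k) 3 (volume : Measure (EuclideanSpace ℝ (Fin 3))) ≤
          (M : ENNReal)) := by
  constructor
  · intro hS v hc hK hd hm hnt _
    exact hS v hc hK hd hm hnt
  · intro hX v hc hK hd hm hnt
    by_cases hper : ∀ t < 0, Torus.IsLatticePeriodic (v t)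
    · obtain ⟨b, hb⟩ := classP_const_of_isLatticePeriodic hc hK hd hm hper
      refine ⟨fun _ => b, fun k => -((k : ℝ) + 1), 0, fun k => by
        have : (0 : ℝ) ≤ k := Nat.cast_nonneg k
        linarith, ?_, fun k => ?_⟩
      · exact tendsto_neg_atTop_atBot.comp
          (tendsto_atTop_add_const_right atTop 1 tendsto_natCast_atTop_atTop)
      · have hk : -((k : ℝ) + 1) < 0 := by
          have : (0 : ℝ) ≤ k := Nat.cast_nonneg k
          linarith
        have hzero : (fun x => v (-((k : ℝ) + 1)) x - b) = 0 := by
          funext x; rw [hb _ hk x, sub_self, Pi.zero_apply]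
        rw [hzero, eLpNorm_zero]
        exact zero_le
    · exact hX v hc hK hd hm hnt hper

end Summit.NavierStokesRegularity.NavierStokesRegularity.Theorems.TypeILiouvilleLatticeMomentum

end
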